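import Literature.MathematicalPhysics.QuantumFieldTheory.Balaban1983to89.B11Eq115Space
import HarnessLib

/-!
# Route `UnitScaleTilt`, crux K1 child «MinimiserStabilityRegPr» (stmt-QuantumFields-19200), leaf V2′ `stub_halvingStep` — PILLAR F4, PART 7:
# **[Balaban1985Variational] PROPOSITION 3's CHART (47)–(62) WITH THE MULTI-LEVEL WEIGHTS OF SECT. F** — the size `|A′|₍₋₁₎ = sup_j L^jη sup_{Ω′_j}|A′|`
# on the cube sequence (144) and block fields on `𝔅_k` ((156)–(157) *«L^jηQ_jA′ = B on Λ′_j, j = 0, 1, …, k»*), typed ONCE over ARBITRARY finite index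
# types `ι` (fine bonds) and `β` (block bonds) with POSITIVE WEIGHTS `w₀` (for `A′`) and `wB` (for `X`, `D(A′)`, `B`); part 2 (`…FlatChart47`) is the
# one-level instance `w₀ = wB = 1`

Cell `ym3-torus` (HUMAN RULING D-0037, YM ladder rung R3), seat `ym-ust-19200-f4` gen 0.  `--supports stmt-QuantumFields-19200 --as helper`;
count-neutral; seventh file of pillar F4 (companion of part 6 `…FlatSmallSolution158Levels`).

THE PRINT ([Balaban1985Variational], CMP **102** (1985)) pp. 285–289: (44) *«|C_j(L^jηA)| ≤ C₂(L^jη)²|A|²»*, (46), (47) *«A = A′ − HD(A′)»*, (48)–(50),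
(51) *«|A′| < ε₃(L^jη)⁻¹ on Ω_j, X = 0 on Λ₀, |X| < ε₃/B₀ on 𝔅_k»*, (53)–(55) *«|D(A′)| ≤ … ≤ 4C₂|A′|²₍₋₁₎»*, (57)–(62), Prop. 3 p. 289; Sect. F p. 302:
*«Now we proceed as in the previous sections, i.e. we make the change of variables A = A′ − HD(A′). The configuration A′ satisfies (152) with 36
instead of 9»*.

WHAT IS PROVED (sorry-free; no definition; axioms standard), for finite `ι β`, weights `w₀ : ι → ℝ`, `wB : β → ℝ` (all `> 0`), fibre `V` finite-dimensional
complex; «size of `A′` ≤ r» := `∀ i, w₀ i·‖A′ i‖ ≤ r`, «size of `X` ≤ t» := `∀ c, wB c·‖X c‖ ≤ t`: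
* **`chart47W`** — for `C` with «size `Y` ≤ r < R ⇒ size `C Y` ≤ C₂r²» and `DifferentiableOn ℂ C` on the open `w₀`-ball of radius `R`, `H` ℂ-linear with
  «size `X` ≤ t ⇒ size `HX` ≤ B₀t», `9C₂B₀ε < 1`, `3ε ≤ R`, `0 < ε`: every `A′` of size `< ε` has EXACTLY ONE `D` of size `≤ 4C₂ε²` with `C(A′ − HD) = D`
  ((49)–(50)); (55) size `D` `≤ 4C₂ρ²` for every size bound `ρ ≥ 0` of `A′`; (48) `Q_lin(A′ − HD) + C(A′ − HD) = Q_lin A′` for every ℂ-linear `Q_lin` with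
  `Q_lin ∘ H = id`.  Mechanism: lit-balaban `B13Contraction113.exists_unique_fixedPoint` / `bound_114` at `𝒴 := NegSup w₀ V`, `𝒳 := NegSup wB V`.
* `size_chart47W_le` ((57)), `chart47W_left_inv`, **`chart47W_range`** ((59)–(62) with the explicit preimage `A + HC(A)`).
HONEST SCOPE as part 2: `C`, `H`, `Q_lin` abstract (pillars C_k / F3); the gradient half (58) is part 2's `grad_chart47_le` pattern (a triangle
inequality, instance-specific); NOT a claim about the mass gap.

References: T. Bałaban, CMP **102** (1985) 277–309 [Balaban1985Variational] (44)–(62) pp.285–287, Prop. 3 p.289, (144)/(156)–(157) pp.300–302.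
-/

set_option autoImplicit false

noncomputable section

open Metric Set

namespace Summit.QuantumFields.YangMills.Theorems.FlatChart47Levels

open Literature.MathematicalPhysics.QuantumFieldTheory.Balaban1983to89
open Literature.MathematicalPhysics.QuantumFieldTheory.Balaban1983to89.B11Eq115Space
open Literature.MathematicalPhysics.QuantumFieldTheory.Balaban1983to89.B13Contraction113
  (QuadAnalytic exists_unique_fixedPoint bound_114)

variable {ι β : Type*} [Fintype ι] [Fintype β] {V : Type*} [NormedAddCommGroup V] [NormedSpace ℂ V]

/-! ## §1 Proposition 3's core with weights -/

/-- **[Balaban1985Variational] PROPOSITION 3 AT BACKGROUND 1, WEIGHTED SIZES** (multi-level cube sequence of Sect. F; any finite index types).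
Data: `C` with «size `Y` ≤ r < R ⇒ size `C Y` ≤ C₂r²» ((44)) and `DifferentiableOn ℂ C` on the `w₀`-ball of radius `R`; `H` ℂ-linear with «size `X` ≤ t ⇒
size `HX` ≤ B₀t» ((46)); `9C₂B₀ε < 1`, `3ε ≤ R`, `0 < ε`.  For every `A′` of size `< ε`: (i) EXACTLY ONE `D` of size `≤ 4C₂ε²` with `C(A′ − HD) = D`; (ii) (55)
size `D` `≤ 4C₂ρ²` for every size bound `ρ ≥ 0` of `A′`; (iii) (48) `Q_lin(A′ − HD) + C(A′ − HD) = Q_lin A′` whenever `Q_lin(HX) = X`.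
[cite: Balaban1985Variational, (47)-(55) pp.285-286, Prop. 3 p.289] -/
theorem chart47W [FiniteDimensional ℂ V] {w₀ : ι → ℝ} {wB : β → ℝ} (hw₀ : ∀ i, 0 < w₀ i) (hwB : ∀ c, 0 < wB c)
    (C : (ι → V) → (β → V)) (H : (β → V) →ₗ[ℂ] (ι → V)) {C₂ R B₀ ε : ℝ} (hC₂ : 0 ≤ C₂) (hB₀ : 0 ≤ B₀)
    (hH : ∀ (X : β → V) (t : ℝ), (∀ c, wB c * ‖X c‖ ≤ t) → ∀ i, w₀ i * ‖H X i‖ ≤ B₀ * t)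
    (hCq : ∀ (Y : ι → V) (r : ℝ), r < R → (∀ i, w₀ i * ‖Y i‖ ≤ r) → ∀ c, wB c * ‖C Y c‖ ≤ C₂ * r ^ 2)
    (hCd : DifferentiableOn ℂ C {Y : ι → V | ∀ i, w₀ i * ‖Y i‖ < R})
    (hq : 9 * C₂ * B₀ * ε < 1) (hR : 3 * ε ≤ R) (hε : 0 < ε) (A' : ι → V) (hA' : ∀ i, w₀ i * ‖A' i‖ < ε) :
    ∃ D : β → V,
      ((∀ c, wB c * ‖D c‖ ≤ 4 * C₂ * ε ^ 2) ∧ C (A' - H D) = D) ∧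
      (∀ D' : β → V, (∀ c, wB c * ‖D' c‖ ≤ 4 * C₂ * ε ^ 2) → C (A' - H D') = D' → D' = D) ∧
      (∀ ρ : ℝ, 0 ≤ ρ → (∀ i, w₀ i * ‖A' i‖ ≤ ρ) → ∀ c, wB c * ‖D c‖ ≤ 4 * C₂ * ρ ^ 2) ∧
      ∀ (Qlin : (ι → V) →ₗ[ℂ] (β → V)), (∀ X, Qlin (H X) = X) → Qlin (A' - H D) + C (A' - H D) = Qlin A' := by
  classical
  haveI : CompleteSpace V := FiniteDimensional.complete ℂ V
  haveI : Fact (∀ i, 0 < w₀ i) := ⟨hw₀⟩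
  haveI : Fact (∀ c, 0 < wB c) := ⟨hwB⟩
  let eY := NegSup.equiv w₀ V
  let eX := NegSup.equiv wB V
  have hρ0 : 0 ≤ 4 * C₂ * ε ^ 2 := by positivity
  have hYle : ∀ (Y : NegSup w₀ V) (r : ℝ), 0 ≤ r → (‖Y‖ ≤ r ↔ ∀ i, w₀ i * ‖eY Y i‖ ≤ r) := fun Y r hr =>
    NegSup.norm_le_iff hr
  have hYlt : ∀ (Y : NegSup w₀ V) (r : ℝ), 0 < r → (‖Y‖ < r ↔ ∀ i, w₀ i * ‖eY Y i‖ < r) := fun Y r hr =>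
    NegSup.norm_lt_iff hr
  have hXle : ∀ (X : NegSup wB V) (t : ℝ), 0 ≤ t → (‖X‖ ≤ t ↔ ∀ c, wB c * ‖eX X c‖ ≤ t) := fun X t ht =>
    NegSup.norm_le_iff ht
  have hYpt : ∀ (Y : NegSup w₀ V) (i : ι), w₀ i * ‖eY Y i‖ ≤ ‖Y‖ := fun Y i => ((hYle Y ‖Y‖ (norm_nonneg _)).1 le_rfl) i
  have hXpt : ∀ (X : NegSup wB V) (c : β), wB c * ‖eX X c‖ ≤ ‖X‖ := fun X c => ((hXle X ‖X‖ (norm_nonneg _)).1 le_rfl) c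
  -- the transported data
  let Hop : NegSup wB V →ₗ[ℂ] NegSup w₀ V :=
    { toFun := fun X => eY.symm (H (eX X))
      map_add' := fun X X' => by
        apply eY.injective; simp only [Equiv.apply_symm_apply, eY, eX, NegSup.equiv_add, map_add]
      map_smul' := fun z X => by
        apply eY.injective; simp only [Equiv.apply_symm_apply, eY, eX, NegSup.equiv_smul, map_smul, RingHom.id_apply] }
  have hHop_apply : ∀ X, eY (Hop X) = H (eX X) := fun X => rfl
  have hHop : ∀ X, ‖Hop X‖ ≤ B₀ * ‖X‖ := by
    intro X
    rw [hYle _ _ (mul_nonneg hB₀ (norm_nonneg _)), hHop_apply]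
    exact hH (eX X) ‖X‖ (hXpt X)
  let Ct : NegSup w₀ V → NegSup wB V := fun Y => eX.symm (C (eY Y))
  have hCt_apply : ∀ Y, eX (Ct Y) = C (eY Y) := fun Y => rfl
  have hCt : QuadAnalytic Ct C₂ R := by
    refine ⟨fun Y hY => ?_, fun Pt Q => ?_⟩
    · rw [hXle _ _ (mul_nonneg hC₂ (sq_nonneg _)), hCt_apply]
      exact hCq (eY Y) ‖Y‖ hY (hYpt Y)
    · have hR0 : ∀ ζ : ℂ, ‖Pt + ζ • Q‖ < R → 0 < R := fun ζ h => (norm_nonneg _).trans_lt h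
      have hline : Differentiable ℂ (fun ζ : ℂ => eY Pt + ζ • eY Q) :=
        (differentiable_const _).add (differentiable_id.smul_const _)
      have hinto : MapsTo (fun ζ : ℂ => eY Pt + ζ • eY Q) {ζ : ℂ | ‖Pt + ζ • Q‖ < R} {Y : ι → V | ∀ i, w₀ i * ‖Y i‖ < R} := by
        intro ζ hζ
        exact (hYlt (Pt + ζ • Q) R (hR0 ζ hζ)).1 hζ
      have hcomp : DifferentiableOn ℂ (fun ζ : ℂ => C (eY Pt + ζ • eY Q)) {ζ : ℂ | ‖Pt + ζ • Q‖ < R} :=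
        hCd.comp hline.differentiableOn hinto
      exact (NegSup.continuousLinearEquiv ℂ wB (V := V)).symm.differentiable.comp_differentiableOn hcomp
  have hA'n : ‖eY.symm A'‖ < ε := (hYlt _ ε hε).2 hA'
  -- the fixed point, abstractly
  obtain ⟨X, hXball, hXfix, hXuniq⟩ := exists_unique_fixedPoint (A' := eY.symm A') hCt hC₂ hB₀ hHop hA'n hq hR
  have hball : ∀ X' : NegSup wB V, X' ∈ closedBall (0 : NegSup wB V) (4 * C₂ * ε ^ 2) ↔ ∀ c, wB c * ‖eX X' c‖ ≤ 4 * C₂ * ε ^ 2 := by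
    intro X'; rw [mem_closedBall_zero_iff, hXle _ _ hρ0]
  -- reading the fixed-point equation on the index
  have hfixread : ∀ X' : NegSup wB V, Ct (eY.symm A' - Hop X') = X' ↔ C (A' - H (eX X')) = eX X' := by
    intro X'
    constructor
    · intro h; exact (congrArg eX h : _)
    · intro h; exact eX.injective h
  refine ⟨eX X, ⟨(hball X).1 hXball, (hfixread X).1 hXfix⟩, fun D' hD' hfix' => ?_, fun ρ hρ hA'ρ c => ?_, fun Qlin hQH => ?_⟩
  · -- uniqueness
    have h1 : eX.symm D' ∈ closedBall (0 : NegSup wB V) (4 * C₂ * ε ^ 2) := (hball _).2 hD'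
    have h2 : Ct (eY.symm A' - Hop (eX.symm D')) = eX.symm D' := (hfixread _).2 hfix'
    have := hXuniq (eX.symm D') h1 h2
    exact (congrArg eX this : _)
  · -- (55)
    have h55 : ‖X‖ ≤ 4 * C₂ * ‖eY.symm A'‖ ^ 2 := bound_114 hCt hC₂ hB₀ hHop hA'n hq hR hXball hXfix
    have hA'le : ‖eY.symm A'‖ ≤ ρ := (hYle _ ρ hρ).2 hA'ρ
    calc wB c * ‖eX X c‖ ≤ ‖X‖ := hXpt X c
      _ ≤ 4 * C₂ * ‖eY.symm A'‖ ^ 2 := h55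
      _ ≤ 4 * C₂ * ρ ^ 2 := mul_le_mul_of_nonneg_left (pow_le_pow_left₀ (norm_nonneg _) hA'le 2) (by positivity)
  · -- (48)
    have hDfix : C (A' - H (eX X)) = eX X := (hfixread X).1 hXfix
    rw [map_sub, hQH, hDfix, sub_add_cancel]

/-! ## §2 (57), the left inverse, and the range (59)–(62), weighted -/

omit [Fintype ι] [Fintype β] [NormedSpace ℂ V] in
/-- **(57), weighted**: for `A = A′ − HD` with size `D` `≤ 4C₂ρ²`, size `A′` `≤ ρ` and «size `X` ≤ t ⇒ size `HX` ≤ B₀t»: size `A` `≤ ρ + B₀·4C₂ρ²`.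
[cite: Balaban1985Variational, (57) p.286] -/
theorem size_chart47W_le [NormedSpace ℂ V] {w₀ : ι → ℝ} {wB : β → ℝ} (hw₀ : ∀ i, 0 < w₀ i) (H : (β → V) →ₗ[ℂ] (ι → V))
    {C₂ B₀ ρ : ℝ} (hH : ∀ (X : β → V) (t : ℝ), (∀ c, wB c * ‖X c‖ ≤ t) → ∀ i, w₀ i * ‖H X i‖ ≤ B₀ * t)
    {A' : ι → V} {D : β → V} (hA' : ∀ i, w₀ i * ‖A' i‖ ≤ ρ) (hD : ∀ c, wB c * ‖D c‖ ≤ 4 * C₂ * ρ ^ 2) :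
    ∀ i, w₀ i * ‖(A' - H D) i‖ ≤ ρ + B₀ * (4 * C₂ * ρ ^ 2) := by
  intro i
  calc w₀ i * ‖(A' - H D) i‖ ≤ w₀ i * (‖A' i‖ + ‖H D i‖) :=
        mul_le_mul_of_nonneg_left (norm_sub_le _ _) (hw₀ i).le
    _ = w₀ i * ‖A' i‖ + w₀ i * ‖H D i‖ := mul_add _ _ _
    _ ≤ ρ + B₀ * (4 * C₂ * ρ ^ 2) := add_le_add (hA' i) (hH D _ hD i)

omit [Fintype ι] [Fintype β] [NormedSpace ℂ V] in
/-- **The chart is injective with explicit left inverse**: `C(A′ − HD) = D ⇒ A′ = A + HC(A)` for `A := A′ − HD` ((59)–(60) read backwards).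
[cite: Balaban1985Variational, (59)-(60) p.287] -/
theorem chart47W_left_inv [NormedSpace ℂ V] (C : (ι → V) → (β → V)) (H : (β → V) →ₗ[ℂ] (ι → V)) {A' : ι → V} {D : β → V}
    (hfix : C (A' - H D) = D) : A' = (A' - H D) + H (C (A' - H D)) := by
  rw [hfix, sub_add_cancel]

/-- **(59)–(62), THE RANGE OF THE CHART, weighted, with the explicit preimage**: under the data of `chart47W`, for `A` of size `< δ` with `0 < δ ≤ ε`
and `δ + B₀C₂δ² ≤ ε`, `A′ := A + HC(A)` has size `< ε`, its `D` is `C(A)`, and `A′ − HD(A′) = A`. [cite: Balaban1985Variational, (59)-(62) p.287, Prop. 3 p.289] -/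
theorem chart47W_range [FiniteDimensional ℂ V] {w₀ : ι → ℝ} {wB : β → ℝ} (hw₀ : ∀ i, 0 < w₀ i) (hwB : ∀ c, 0 < wB c)
    (C : (ι → V) → (β → V)) (H : (β → V) →ₗ[ℂ] (ι → V)) {C₂ R B₀ ε δ : ℝ} (hC₂ : 0 ≤ C₂) (hB₀ : 0 ≤ B₀)
    (hH : ∀ (X : β → V) (t : ℝ), (∀ c, wB c * ‖X c‖ ≤ t) → ∀ i, w₀ i * ‖H X i‖ ≤ B₀ * t)
    (hCq : ∀ (Y : ι → V) (r : ℝ), r < R → (∀ i, w₀ i * ‖Y i‖ ≤ r) → ∀ c, wB c * ‖C Y c‖ ≤ C₂ * r ^ 2)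
    (hCd : DifferentiableOn ℂ C {Y : ι → V | ∀ i, w₀ i * ‖Y i‖ < R})
    (hq : 9 * C₂ * B₀ * ε < 1) (hR : 3 * ε ≤ R) (hδ0 : 0 < δ) (hδε : δ ≤ ε) (hδ : δ + B₀ * (C₂ * δ ^ 2) ≤ ε)
    (A : ι → V) (hA : ∀ i, w₀ i * ‖A i‖ < δ) :
    (∀ i, w₀ i * ‖(A + H (C A)) i‖ < ε) ∧
      (∀ c, wB c * ‖C A c‖ ≤ 4 * C₂ * ε ^ 2) ∧ C ((A + H (C A)) - H (C A)) = C A ∧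
      (∀ D' : β → V, (∀ c, wB c * ‖D' c‖ ≤ 4 * C₂ * ε ^ 2) → C ((A + H (C A)) - H D') = D' → D' = C A) ∧
      (A + H (C A)) - H (C A) = A := by
  classical
  haveI : Fact (∀ i, 0 < w₀ i) := ⟨hw₀⟩
  let eY := NegSup.equiv w₀ V
  have hε : 0 < ε := hδ0.trans_le hδε
  have hδR : δ < R := by linarith
  -- ‖A‖ < δ in the weighted sup norm; pointwise sizes ≤ ‖A‖
  have hAn : ‖eY.symm A‖ < δ := (NegSup.norm_lt_iff hδ0).2 hA
  have hApt : ∀ i, w₀ i * ‖A i‖ ≤ ‖eY.symm A‖ := fun i => NegSup.weight_mul_norm_apply_le (eY.symm A) i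
  have hCA : ∀ c, wB c * ‖C A c‖ ≤ C₂ * ‖eY.symm A‖ ^ 2 := hCq A ‖eY.symm A‖ (hAn.trans hδR) hApt
  have hsq : ‖eY.symm A‖ ^ 2 < δ ^ 2 := by
    have := hAn; nlinarith [norm_nonneg (eY.symm A)]
  have hCAδ : ∀ c, wB c * ‖C A c‖ ≤ C₂ * δ ^ 2 := fun c =>
    (hCA c).trans (mul_le_mul_of_nonneg_left hsq.le hC₂)
  have hA'lt : ∀ i, w₀ i * ‖(A + H (C A)) i‖ < ε := by
    intro i
    have h1 : w₀ i * ‖H (C A) i‖ ≤ B₀ * (C₂ * δ ^ 2) := hH (C A) _ hCAδ i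
    calc w₀ i * ‖(A + H (C A)) i‖ ≤ w₀ i * (‖A i‖ + ‖H (C A) i‖) :=
          mul_le_mul_of_nonneg_left (norm_add_le _ _) (hw₀ i).le
      _ = w₀ i * ‖A i‖ + w₀ i * ‖H (C A) i‖ := mul_add _ _ _
      _ < δ + B₀ * (C₂ * δ ^ 2) := add_lt_add_of_lt_of_le (hA i) h1
      _ ≤ ε := hδ
  have hCAball : ∀ c, wB c * ‖C A c‖ ≤ 4 * C₂ * ε ^ 2 := by
    intro c
    refine (hCAδ c).trans ?_
    have h3 : δ ^ 2 ≤ ε ^ 2 := pow_le_pow_left₀ hδ0.le hδε 2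
    nlinarith [sq_nonneg ε]
  have hcancel : (A + H (C A)) - H (C A) = A := add_sub_cancel_right _ _
  obtain ⟨D, ⟨-, -⟩, hDuniq, -, -⟩ := chart47W hw₀ hwB C H hC₂ hB₀ hH hCq hCd hq hR hε (A + H (C A)) hA'lt
  have hfixCA : C ((A + H (C A)) - H (C A)) = C A := by rw [hcancel]
  have hDCA : C A = D := hDuniq (C A) hCAball hfixCA
  refine ⟨hA'lt, hCAball, hfixCA, fun D' hD' hfix' => ?_, hcancel⟩
  rw [hDuniq D' hD' hfix', ← hDCA]

end Summit.QuantumFields.YangMills.Theorems.FlatChart47Levels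

end
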